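import Mathlib
import Summits.Ventures.PercRepro2.Defs
import Summits.Ventures.PercRepro2.Harris
import Summits.Ventures.PercRepro2.Independence
import Summits.Ventures.PercRepro2.CoinDefs
import Summits.Ventures.PercRepro2.CoinReverse
import Summits.Ventures.PercRepro2.CoinStarDefs
import Summits.Ventures.PercRepro2.CoinLsmCoreDefs
import Summits.Ventures.PercRepro2.CoinLsmCoreU
import Summits.Ventures.PercRepro2.CoinCoreGate
import Summits.Ventures.PercRepro2.CoinOrTailAlg
import Summits.Ventures.PercRepro2.CoinOrTailDefs
import Summits.Ventures.PercRepro2.CoinOrTailLsmDefs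
import Summits.Ventures.PercRepro2.CoinOrTailLsmSums
import Summits.Ventures.PercRepro2.CoinOrTailBlockAlg
import Summits.Ventures.PercRepro2.CoinOrTailBlockSums
import Summits.Ventures.PercRepro2.CoinOrTailMixLsm
import Summits.Ventures.PercRepro2.CoinLsmCoreSure
import Summits.Ventures.PercRepro2.CoinOrTailKDefs
import Summits.Ventures.PercRepro2.CoinOrTailKSums
import Summits.Ventures.PercRepro2.CoinOrTailKAlg
import Summits.Ventures.PercRepro2.CoinOrTailCovCore
import Summits.Ventures.PercRepro2.CoinOrTailKCore
import Summits.Ventures.PercRepro2.CoinOrTailKOneAlg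
import Summits.Ventures.PercRepro2.CoinK2HeadBlindVals
import Summits.Ventures.PercRepro2.CoinK2HeadAwareAD
import Summits.Ventures.PercRepro2.CoinK2HeadAwareCoinsAlg
import Summits.Ventures.PercRepro2.CoinTreeCore
import Summits.Ventures.PercRepro2.CoinKSureLayer
import Summits.Ventures.PercRepro2.CoinKSureAD
import Summits.Ventures.PercRepro2.CoinKSureFibers
import Summits.Ventures.PercRepro2.CoinKSureGate
import Summits.Ventures.PercRepro2.CoinKSureCore
import Summits.Ventures.PercRepro2.CoinKSureCoinsAlg

/-!
# Row 2′DARC at an OR-tail with ANY entry set and ARBITRARY coin probabilities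
(blind cell PercRepro2, night-2 g14; proofs/NIGHT2-DARC.md §49.7)

`orTailK_functional_nonneg_coins_aux`: induction on the set `S` of entries whose coins are not
sure — each step splits one such coin into a virtual sure entry (`ext_sum_one`,
`extLaw_lsm`, `extHead_*` of `CoinKSureCoinsAlg`), the base case is the sure-entry theorem
`orTailKSure_functional_nonneg`.  The virtual labels are an injective map `vt` of the entries
into vertices outside `U ∪ {a, w}`.

`darc_of_orTailK_coins`: row 2′DARC at `a → w` for ANY entry set, ANY coin probabilities, ANY
two markers, every head, every probability vector, given such a labelling;
`darc_of_orTailTreeK_coins` the out-tree corollary. -/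

namespace Summit.Ventures.PercRepro2.Coin

open Classical

section CoinsInduction

variable {V : Type*} {E : Type*} [Fintype V] [DecidableEq V] {R : Type*} [Field R] [LinearOrder R]
  [IsStrictOrderedRing R]

/-- **Induction on the non-sure entries.** For every finset `S` containing the entries whose
coins are not sure, with an injective labelling `vt` of `S` into vertices outside `U ∪ {a, w}`,
the OR-tail functional is nonnegative. -/
theorem orTailK_functional_nonneg_coins_aux (S : Finset V) :
    ∀ (U : Finset V) (ν A : Finset V → R) (pr : E → R) (ent : Finset V) (c : V → E) (vt : V → V)
      (m₁ m₂ a w : V),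
      (∀ e, 0 ≤ pr e) → (∀ e, pr e ≤ 1) →
      (∀ W, 0 ≤ ν W) → (∀ s ⊆ U, ∀ t ⊆ U, ν s * ν t ≤ ν (s ∩ t) * ν (s ∪ t)) →
      (∀ W, 0 ≤ A W) → (∀ s t : Finset V, A s * A t ≤ A (s ∩ t) * A (s ∪ t)) →
      (∀ s t : Finset V, s ⊆ t → A t ≤ A s) →
      ent ⊆ U → (∀ q ∈ ent, ∀ q' ∈ ent, c q = c q' → q = q') →
      (∀ q ∈ ent, pr (c q) ≠ 1 → q ∈ S) →
      (∀ q ∈ S, vt q ∉ U ∧ vt q ≠ a ∧ vt q ≠ w) →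
      (∀ q ∈ S, ∀ q' ∈ S, vt q = vt q' → q = q') →
      m₁ ∈ U → m₂ ∈ U →
      0 ≤ (∑ W ∈ U.powerset, ν W * rValK A pr ent c a W) ^ 2 *
            (∑ W ∈ U.powerset, ν W * gValK A pr ent c a w W *
              ((if m₁ ∈ W then (1 : R) else 0) * (if m₂ ∈ W then (1 : R) else 0)))
          - (∑ W ∈ U.powerset, ν W * rValK A pr ent c a W) *
            (∑ W ∈ U.powerset, ν W * rValK A pr ent c a W * (if m₁ ∈ W then (1 : R) else 0)) *
            (∑ W ∈ U.powerset, ν W * gValK A pr ent c a w W * (if m₂ ∈ W then (1 : R) else 0))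
          - (∑ W ∈ U.powerset, ν W * rValK A pr ent c a W) *
            (∑ W ∈ U.powerset, ν W * rValK A pr ent c a W * (if m₂ ∈ W then (1 : R) else 0)) *
            (∑ W ∈ U.powerset, ν W * gValK A pr ent c a w W * (if m₁ ∈ W then (1 : R) else 0))
          + (∑ W ∈ U.powerset, ν W * rValK A pr ent c a W * (if m₁ ∈ W then (1 : R) else 0)) *
            (∑ W ∈ U.powerset, ν W * rValK A pr ent c a W * (if m₂ ∈ W then (1 : R) else 0)) *
            (∑ W ∈ U.powerset, ν W * gValK A pr ent c a w W) := by
  induction S using Finset.induction_on with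
  | empty =>
    intro U ν A pr ent c vt m₁ m₂ a w hp0 hp1 hν0 hν hA0 hA hmono hentU hcinj hS hvt hvtinj hm₁ hm₂
    have hsure : ∀ r ∈ ent, pr (c r) = 1 := fun r hr => by
      by_contra h
      exact Finset.notMem_empty r (hS r hr h)
    exact orTailKSure_functional_nonneg U ν A pr ent c m₁ m₂ a w hp0 hp1 hsure hν0 hν hA0 hA hmono
  | insert r S₀ hrS₀ ih =>
    intro U ν A pr ent c vt m₁ m₂ a w hp0 hp1 hν0 hν hA0 hA hmono hentU hcinj hS hvt hvtinj hm₁ hm₂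
    by_cases hr : r ∈ ent ∧ pr (c r) ≠ 1
    · obtain ⟨hrent, hrne⟩ := hr
      have hrS : r ∈ insert r S₀ := Finset.mem_insert_self r S₀
      have hr'U : vt r ∉ U := (hvt r hrS).1
      have hr'a : vt r ≠ a := (hvt r hrS).2.1
      have hr'w : vt r ≠ w := (hvt r hrS).2.2
      have hr'V : vt r ∉ U ∪ {a, w} := by
        simp only [Finset.mem_union, Finset.mem_insert, Finset.mem_singleton, not_or]
        exact ⟨hr'U, hr'a, hr'w⟩
      have hUV : U ⊆ U ∪ {a, w} := Finset.subset_union_left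
      have haV : ({a} : Finset V) ⊆ U ∪ {a, w} := by
        intro x hx
        rw [Finset.mem_singleton] at hx
        rw [hx]
        exact Finset.mem_union_right _ (Finset.mem_insert_self _ _)
      have hawV : ({a, w} : Finset V) ⊆ U ∪ {a, w} := Finset.subset_union_right
      have hcinj' : ∀ q ∈ ent, c q = c r → q = r := fun q hq h => hcinj q hq r hrent h
      have hm₁r' : m₁ ≠ vt r := fun h => hr'U (h ▸ hm₁)
      have hm₂r' : m₂ ≠ vt r := fun h => hr'U (h ▸ hm₂)
      -- the extended system
      set ν' : Finset V → R := fun W' => ν (W' ∩ U) *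
        (if vt r ∈ W' then (if r ∈ W' then pr (c r) else 0)
          else (if r ∈ W' then 1 - pr (c r) else 1)) with hν'
      set A' : Finset V → R := fun Y => A (Y ∩ (U ∪ {a, w})) with hA'
      set pr' : E → R := fun e => if e = c r then (1 : R) else pr e with hpr'
      set c' : V → E := fun v => if v = vt r then c r else c v with hc'
      -- the hypotheses of the induction hypothesis for the extended system
      have hp0' : ∀ e, 0 ≤ pr' e := by
        intro e; simp only [hpr']; split_ifs <;> [exact zero_le_one; exact hp0 e]
      have hp1' : ∀ e, pr' e ≤ 1 := by
        intro e; simp only [hpr']; split_ifs <;> [exact le_rfl; exact hp1 e]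
      have hν'0 : ∀ W, 0 ≤ ν' W := fun W =>
        extLaw_nonneg U ν r (vt r) (pr (c r)) (hp0 _) (hp1 _) hν0 W
      have hν'lsm : ∀ s ⊆ insert (vt r) U, ∀ t ⊆ insert (vt r) U,
          ν' s * ν' t ≤ ν' (s ∩ t) * ν' (s ∪ t) :=
        extLaw_lsm U ν r (vt r) (pr (c r)) (hp0 _) (hp1 _) hν0 hν
      have hA'0 : ∀ W, 0 ≤ A' W := fun W => hA0 _
      have hA'lsm : ∀ s t : Finset V, A' s * A' t ≤ A' (s ∩ t) * A' (s ∪ t) :=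
        extHead_lsm A (U ∪ {a, w}) hA
      have hA'mono : ∀ s t : Finset V, s ⊆ t → A' t ≤ A' s := extHead_mono A (U ∪ {a, w}) hmono
      have hent'U' : insert (vt r) (ent.erase r) ⊆ insert (vt r) U :=
        Finset.insert_subset_insert _ ((Finset.erase_subset r ent).trans hentU)
      have hq_ne : ∀ q ∈ ent.erase r, q ≠ vt r := fun q hq h =>
        hr'U (h ▸ hentU (Finset.mem_of_mem_erase hq))
      have hc'inj : ∀ q ∈ insert (vt r) (ent.erase r), ∀ q' ∈ insert (vt r) (ent.erase r),
          c' q = c' q' → q = q' := by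
        intro q hq q' hq' hcc
        simp only [hc'] at hcc
        rw [Finset.mem_insert] at hq hq'
        rcases hq with rfl | hq <;> rcases hq' with rfl | hq'
        · rfl
        · rw [if_pos rfl, if_neg (hq_ne q' hq')] at hcc
          exact absurd (hcinj' q' (Finset.mem_of_mem_erase hq') hcc.symm)
            (Finset.ne_of_mem_erase hq')
        · rw [if_neg (hq_ne q hq), if_pos rfl] at hcc
          exact absurd (hcinj' q (Finset.mem_of_mem_erase hq) hcc) (Finset.ne_of_mem_erase hq)
        · rw [if_neg (hq_ne q hq), if_neg (hq_ne q' hq')] at hcc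
          exact hcinj q (Finset.mem_of_mem_erase hq) q' (Finset.mem_of_mem_erase hq') hcc
      have hS' : ∀ q ∈ insert (vt r) (ent.erase r), pr' (c' q) ≠ 1 → q ∈ S₀ := by
        intro q hq hne
        rw [Finset.mem_insert] at hq
        rcases hq with rfl | hq
        · exfalso
          apply hne
          simp only [hc', hpr', if_pos rfl]
        · have hqent : q ∈ ent := Finset.mem_of_mem_erase hq
          have hqr : q ≠ r := Finset.ne_of_mem_erase hq
          have hcq : c q ≠ c r := fun h => hqr (hcinj' q hqent h)
          simp only [hc', hpr', if_neg (hq_ne q hq), if_neg hcq] at hne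
          have := hS q hqent hne
          rw [Finset.mem_insert] at this
          rcases this with h | h
          · exact absurd h hqr
          · exact h
      have hvt' : ∀ q ∈ S₀, vt q ∉ insert (vt r) U ∧ vt q ≠ a ∧ vt q ≠ w := by
        intro q hq
        have hqS : q ∈ insert r S₀ := Finset.mem_insert_of_mem hq
        obtain ⟨h1, h2, h3⟩ := hvt q hqS
        refine ⟨?_, h2, h3⟩
        rw [Finset.mem_insert, not_or]
        refine ⟨?_, h1⟩
        intro heq
        have := hvtinj q hqS r hrS heq
        rw [this] at hq
        exact hrS₀ hq
      have hvtinj' : ∀ q ∈ S₀, ∀ q' ∈ S₀, vt q = vt q' → q = q' := fun q hq q' hq' h =>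
        hvtinj q (Finset.mem_insert_of_mem hq) q' (Finset.mem_insert_of_mem hq') h
      have hm₁' : m₁ ∈ insert (vt r) U := Finset.mem_insert_of_mem hm₁
      have hm₂' : m₂ ∈ insert (vt r) U := Finset.mem_insert_of_mem hm₂
      have key := ih (insert (vt r) U) ν' A' pr' (insert (vt r) (ent.erase r)) c' vt m₁ m₂ a w
        hp0' hp1' hν'0 hν'lsm hA'0 hA'lsm hA'mono hent'U' hc'inj hS' hvt' hvtinj' hm₁' hm₂'
      -- the marker functions are blind to the virtual vertex
      have hJ1 : ∀ W ⊆ U, (fun _ : Finset V => (1 : R)) (insert (vt r) W) =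
          (fun _ : Finset V => (1 : R)) W := fun _ _ => rfl
      have hJx : ∀ W ⊆ U, (fun W : Finset V => if m₁ ∈ W then (1 : R) else 0) (insert (vt r) W) =
          (fun W : Finset V => if m₁ ∈ W then (1 : R) else 0) W := by
        intro W _; simp only [Finset.mem_insert, hm₁r', false_or]
      have hJy : ∀ W ⊆ U, (fun W : Finset V => if m₂ ∈ W then (1 : R) else 0) (insert (vt r) W) =
          (fun W : Finset V => if m₂ ∈ W then (1 : R) else 0) W := by
        intro W _; simp only [Finset.mem_insert, hm₂r', false_or]
      have hJxy : ∀ W ⊆ U,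
          (fun W : Finset V => (if m₁ ∈ W then (1 : R) else 0) * (if m₂ ∈ W then (1 : R) else 0))
            (insert (vt r) W) =
          (fun W : Finset V => (if m₁ ∈ W then (1 : R) else 0) * (if m₂ ∈ W then (1 : R) else 0))
            W := by
        intro W _; simp only [Finset.mem_insert, hm₁r', hm₂r', false_or]
      -- the seven sums of the extended system are those of the original one
      have eR1 : (∑ W ∈ (insert (vt r) U).powerset, ν' W * rValK A' pr' (insert (vt r) (ent.erase r)) c' a W) =
          ∑ W ∈ U.powerset, ν W * rValK A pr ent c a W := by
        have e' : (∑ W ∈ (insert (vt r) U).powerset,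
            ν' W * rValK A' pr' (insert (vt r) (ent.erase r)) c' a W * (1 : R)) =
            ∑ W ∈ U.powerset, ν W * rValK A pr ent c a W * (1 : R) :=
          ext_sum_one U ν A pr ent c r (vt r) {a} (U ∪ {a, w}) (fun _ => (1 : R))
            hrent hentU hUV haV hr'V hcinj' hJ1
        simpa only [mul_one] using e'
      have eRx : (∑ W ∈ (insert (vt r) U).powerset, ν' W * rValK A' pr' (insert (vt r) (ent.erase r)) c' a W *
            (if m₁ ∈ W then (1 : R) else 0)) =
          ∑ W ∈ U.powerset, ν W * rValK A pr ent c a W * (if m₁ ∈ W then (1 : R) else 0) :=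
        ext_sum_one U ν A pr ent c r (vt r) {a} (U ∪ {a, w})
          (fun W => if m₁ ∈ W then (1 : R) else 0) hrent hentU hUV haV hr'V hcinj' hJx
      have eRy : (∑ W ∈ (insert (vt r) U).powerset, ν' W * rValK A' pr' (insert (vt r) (ent.erase r)) c' a W *
            (if m₂ ∈ W then (1 : R) else 0)) =
          ∑ W ∈ U.powerset, ν W * rValK A pr ent c a W * (if m₂ ∈ W then (1 : R) else 0) :=
        ext_sum_one U ν A pr ent c r (vt r) {a} (U ∪ {a, w})
          (fun W => if m₂ ∈ W then (1 : R) else 0) hrent hentU hUV haV hr'V hcinj' hJy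
      have eG1 : (∑ W ∈ (insert (vt r) U).powerset, ν' W * gValK A' pr' (insert (vt r) (ent.erase r)) c' a w W) =
          ∑ W ∈ U.powerset, ν W * gValK A pr ent c a w W := by
        have e' : (∑ W ∈ (insert (vt r) U).powerset,
            ν' W * gValK A' pr' (insert (vt r) (ent.erase r)) c' a w W * (1 : R)) =
            ∑ W ∈ U.powerset, ν W * gValK A pr ent c a w W * (1 : R) :=
          ext_sum_one U ν A pr ent c r (vt r) {a, w} (U ∪ {a, w}) (fun _ => (1 : R))
            hrent hentU hUV hawV hr'V hcinj' hJ1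
        simpa only [mul_one] using e'
      have eGx : (∑ W ∈ (insert (vt r) U).powerset, ν' W * gValK A' pr' (insert (vt r) (ent.erase r)) c' a w W *
            (if m₁ ∈ W then (1 : R) else 0)) =
          ∑ W ∈ U.powerset, ν W * gValK A pr ent c a w W * (if m₁ ∈ W then (1 : R) else 0) :=
        ext_sum_one U ν A pr ent c r (vt r) {a, w} (U ∪ {a, w})
          (fun W => if m₁ ∈ W then (1 : R) else 0) hrent hentU hUV hawV hr'V hcinj' hJx
      have eGy : (∑ W ∈ (insert (vt r) U).powerset, ν' W * gValK A' pr' (insert (vt r) (ent.erase r)) c' a w W *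
            (if m₂ ∈ W then (1 : R) else 0)) =
          ∑ W ∈ U.powerset, ν W * gValK A pr ent c a w W * (if m₂ ∈ W then (1 : R) else 0) :=
        ext_sum_one U ν A pr ent c r (vt r) {a, w} (U ∪ {a, w})
          (fun W => if m₂ ∈ W then (1 : R) else 0) hrent hentU hUV hawV hr'V hcinj' hJy
      have eGxy : (∑ W ∈ (insert (vt r) U).powerset, ν' W * gValK A' pr' (insert (vt r) (ent.erase r)) c' a w W *
            ((if m₁ ∈ W then (1 : R) else 0) * (if m₂ ∈ W then (1 : R) else 0))) =
          ∑ W ∈ U.powerset, ν W * gValK A pr ent c a w W *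
            ((if m₁ ∈ W then (1 : R) else 0) * (if m₂ ∈ W then (1 : R) else 0)) :=
        ext_sum_one U ν A pr ent c r (vt r) {a, w} (U ∪ {a, w})
          (fun W => (if m₁ ∈ W then (1 : R) else 0) * (if m₂ ∈ W then (1 : R) else 0))
          hrent hentU hUV hawV hr'V hcinj' hJxy
      rw [eR1, eRx, eRy, eG1, eGx, eGy, eGxy] at key
      exact key
    · -- the coin of `r` is sure or `r` is not an entry: nothing to split
      have hS' : ∀ q ∈ ent, pr (c q) ≠ 1 → q ∈ S₀ := by
        intro q hq hne
        have := hS q hq hne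
        rw [Finset.mem_insert] at this
        rcases this with h | h
        · exact absurd ⟨h ▸ hq, h ▸ hne⟩ hr
        · exact h
      have hvt' : ∀ q ∈ S₀, vt q ∉ U ∧ vt q ≠ a ∧ vt q ≠ w :=
        fun q hq => hvt q (Finset.mem_insert_of_mem hq)
      have hvtinj' : ∀ q ∈ S₀, ∀ q' ∈ S₀, vt q = vt q' → q = q' := fun q hq q' hq' h =>
        hvtinj q (Finset.mem_insert_of_mem hq) q' (Finset.mem_insert_of_mem hq') h
      exact ih U ν A pr ent c vt m₁ m₂ a w hp0 hp1 hν0 hν hA0 hA hmono hentU hcinj hS' hvt'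
        hvtinj' hm₁ hm₂

end CoinsInduction

section CoinsMain

variable {V : Type*} {E : Type*} [Fintype V] [DecidableEq V] [Fintype E] [DecidableEq E]
  {R : Type*} [Field R] [LinearOrder R] [IsStrictOrderedRing R]
  {arcs : E → Finset (V × V)} {s : V} {U : Finset V} {ent : Finset V} {c : V → E} {a w : V}

/-- **THEOREM (row 2′DARC at an OR-tail with ANY entry set and ARBITRARY coins — ANY head,
ANY markers).** `OrTailK arcs s U ent c a` with an arbitrary entry set and arbitrary tail coin
probabilities, `SameEnds`, the cluster law of `U` log-supermodular (`hν`), ANY two markers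
`m₁, m₂ ∈ U`, an injective labelling `vt` of the entries by vertices outside `U ∪ {a, w}`,
`t, w ∉ U ∪ {a, s}` ⟹ `Φ_D({s ↛ t in D + (a → w)}) ≥ 0` for the markers `m₁, m₂` at every
head, every probability vector. -/
theorem darc_of_orTailK_coins (pr : E → R) (hp : IsProbVec pr) (hS : SameEnds arcs)
    (h : OrTailK arcs s U ent c a) {m₁ m₂ : V} (hm₁ : m₁ ∈ U) (hm₂ : m₂ ∈ U)
    (vt : V → V) (hvt : ∀ r ∈ ent, vt r ∉ U ∧ vt r ≠ a ∧ vt r ≠ w)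
    (hvtinj : ∀ r ∈ ent, ∀ r' ∈ ent, vt r = vt r' → r = r')
    (hν : ∀ W W', W ⊆ U → W' ⊆ U →
      prob pr (coreLevel arcs s U W) * prob pr (coreLevel arcs s U W') ≤
        prob pr (coreLevel arcs s U (W ∩ W')) * prob pr (coreLevel arcs s U (W ∪ W')))
    {t : V} (htC : t ∉ insert a U) (hts : t ≠ s) (hws : w ≠ s) (hwC : w ∉ insert a U) :
    DARC pr arcs s {t} m₁ m₂ a w := by
  have hC := h.closedInCoreU
  have hm₁a : m₁ ≠ a := fun e => h.a_notin (e ▸ hm₁)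
  have hm₂a : m₂ ≠ a := fun e => h.a_notin (e ▸ hm₂)
  have hm₁C : m₁ ∈ insert a U := Finset.mem_insert_of_mem hm₁
  have hm₂C : m₂ ∈ insert a U := Finset.mem_insert_of_mem hm₂
  have haC : a ∈ insert a U := Finset.mem_insert_self _ _
  unfold DARC
  rw [hC.phiC_gate_eq pr hS htC hts hm₁C hm₂C haC hws hwC]
  have hm1 : ∀ W : Finset V, (fun _ : Finset V => (1 : R)) (insert a W) = (fun _ => (1 : R)) W :=
    fun _ => rfl
  have hmp : ∀ W : Finset V, (fun W : Finset V => if m₁ ∈ W then (1 : R) else 0) (insert a W) =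
      (fun W : Finset V => if m₁ ∈ W then (1 : R) else 0) W := by
    intro W; simp only [Finset.mem_insert, hm₁a, false_or]
  have hmq : ∀ W : Finset V, (fun W : Finset V => if m₂ ∈ W then (1 : R) else 0) (insert a W) =
      (fun W : Finset V => if m₂ ∈ W then (1 : R) else 0) W := by
    intro W; simp only [Finset.mem_insert, hm₂a, false_or]
  have hmpq : ∀ W : Finset V,
      (fun W : Finset V => (if m₁ ∈ W then (1 : R) else 0) * (if m₂ ∈ W then (1 : R) else 0))
        (insert a W) =
      (fun W : Finset V => (if m₁ ∈ W then (1 : R) else 0) * (if m₂ ∈ W then (1 : R) else 0)) W := by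
    intro W; simp only [Finset.mem_insert, hm₁a, hm₂a, false_or]
  have eΛ := h.sum_R_eq pr t (fun _ => (1 : R)) hm1
  have eFa := h.sum_R_eq pr t (fun W => if m₁ ∈ W then (1 : R) else 0) hmp
  have eFb := h.sum_R_eq pr t (fun W => if m₂ ∈ W then (1 : R) else 0) hmq
  have eM := h.sum_G_eq (w := w) pr t (fun _ => (1 : R)) hm1
  have eX := h.sum_G_eq (w := w) pr t (fun W => if m₁ ∈ W then (1 : R) else 0) hmp
  have eY := h.sum_G_eq (w := w) pr t (fun W => if m₂ ∈ W then (1 : R) else 0) hmq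
  have eXY := h.sum_G_eq (w := w) pr t
    (fun W => (if m₁ ∈ W then (1 : R) else 0) * (if m₂ ∈ W then (1 : R) else 0)) hmpq
  simp only [mul_one] at eΛ eM
  rw [eΛ, eFa, eFb, eM, eX, eY, eXY]
  obtain ⟨hA0, hAmono, hAlsm⟩ := OrTailU.head_props (U := U) (a := a) pr hp hS t
  exact orTailK_functional_nonneg_coins_aux ent U (fun W => prob pr (coreLevel arcs s U W))
    (fun X => prob pr (coreAvoidEvent arcs s t (insert a U) X)) pr ent c vt m₁ m₂ a w
    hp.nonneg hp.le_one (fun W => prob_nonneg hp _)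
    (fun s' hs' t' ht' => hν s' t' hs' ht') hA0 hAlsm hAmono h.ent_sub h.c_inj
    (fun q hq _ => hq) hvt hvtinj hm₁ hm₂

/-- **COROLLARY (out-tree core, any entry set, arbitrary coins, any head).** -/
theorem darc_of_orTailTreeK_coins (pr : E → R) (hp : IsProbVec pr) (hS : SameEnds arcs)
    (h : OrTailK arcs s U ent c a) {c' : V → E} {par : V → V} {rk : V → ℕ}
    (hT : TreeCore arcs s U c' par rk) {m₁ m₂ : V} (hm₁ : m₁ ∈ U) (hm₂ : m₂ ∈ U)
    (vt : V → V) (hvt : ∀ r ∈ ent, vt r ∉ U ∧ vt r ≠ a ∧ vt r ≠ w)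
    (hvtinj : ∀ r ∈ ent, ∀ r' ∈ ent, vt r = vt r' → r = r')
    {t : V} (htC : t ∉ insert a U) (hts : t ≠ s) (hws : w ≠ s) (hwC : w ∉ insert a U) :
    DARC pr arcs s {t} m₁ m₂ a w :=
  darc_of_orTailK_coins pr hp hS h hm₁ hm₂ vt hvt hvtinj (hT.coreLevel_lsm pr hp) htC hts hws hwC

end CoinsMain

end Summit.Ventures.PercRepro2.Coin
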